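import Summits.NavierStokesRegularity.NavierStokesRegularity.Theorems.FrozenSignCascadeBoundedEnvelopeContinuationSmallMorrey
import Summits.NavierStokesRegularity.NavierStokesRegularity.Theorems.HardyPointSinkHardyAncientLimitClassical
import Literature.Analysis.FluidPDE.CKNEpsilonRegularityHolds
import Literature.Analysis.FluidPDE.Seregin2020CubicLowerBound
import Literature.Analysis.FluidPDE.SlabPressureNormalization
import Literature.Analysis.FluidPDE.SelfSimilar
import HarnessLib

/-!
# Route FrozenSignCascade · crux `BoundedEnvelopeContinuation` — the small-Morrey regime, part 2:
# the Liouville statement (L_M) for a SMALL Morrey constant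

Helper file for the crux item stmt-NavierStokesRegularity-10579 (`BoundedEnvelopeContinuation`,
conjunct (B) of route `FrozenSignCascade`), line `registered` (reshape r3); lands `--supports`
that item. Sequel of `…SmallMorrey.lean`.

**Theorem (`liouvilleMorrey_small`, registered sub-goal of the open stub).** There is
a universal `M₀ > 0` such that every bounded ancient mild solution `v` of Navier–Stokes (`ν = 1`)
on `(-∞,0) × ℝ³`, jointly smooth and Oseen-mild there, whose slices obey the scale-invariant
Morrey bound `∫_{B_r(y)} ‖v t‖² ≤ M₀ r` for ALL `t < 0`, `y`, `r > 0`, vanishes identically. This is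
the small-constant case of the line's one open stub `stub_liouvilleMorrey` (L_M) (which asks the
same for an ARBITRARY Morrey constant = Type-I exclusion, open); equivalently, a mild bounded
ancient solution that is NOT identically zero has Morrey constant `> M₀` at some ball — the
Morrey-space form of the minimal blow-up concentration.

**Proof.** Let `(ε₀, C₀)` be the constants of the Caffarelli–Kohn–Nirenberg ε-regularity
criterion at unit scale (Lemarié-Rieusset 2016, Thm 14.4, PROVED in the tree:
`lemarieRieusset_epsilon_regularity_nu_one_holds`), `l = ε₀`, and `M₀` the threshold of part 1
(`cknC_cknDOsc_small_of_morrey`) for `η = l³/5`. Fix `t < 0`, `x` and a zoom factor `c` with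
`c² > -4t`. The zoom `w(s,y) = c v(c²s, x + cy)` about `(0, x)` is, with the zoomed classical
pressure, again a bounded classical solution on `(-∞,0)` with the SAME Morrey constant
(`zoom_setting`), so `C(Q(0,1); w) ≤ η` and `D(Q(0,1)) ≤ η` (part 1). Gauging the pressure by its
unit-ball mean (`IsSuitableWeakSolutionOn.sub_unitBallMean_slab`, `cknDOsc_sub_fun_time`,
`lintegral_pressure_le_of_unitBallMean_eq_zero`: `∫_{Q(0,1)} |p̃|^{3/2} ≤ 4 D`) the pair is a
suitable weak solution on the top-touching cylinder `Q(0,1)` in Lemarié-Rieusset's §14.3 class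
(`Seregin2020.exists_isLRSuitableWeakSolutionOn_of_finite`; `E < ∞` by lead c2's bootstrap) with
`∫_{Q(0,1)} |w|³ + |p̃|^{3/2} ≤ 5η = l³`, whence `|w| ≤ C₀ l` a.e. on `Q(0,½)`, everywhere by
continuity. At `(s, y) = (t/c², 0) ∈ Q(0,½)` this reads `c ‖v(t,x)‖ ≤ C₀ l`; `c → ∞` gives
`v(t,x) = 0`.

## References

* L. Caffarelli, R. Kohn, L. Nirenberg, Comm. Pure Appl. Math. 35 (1982), Prop. 1, Cor. 1.
  [CaffarelliKohnNirenberg1982]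
* P. G. Lemarié-Rieusset, *The Navier–Stokes problem in the 21st century* (2016), Thm 14.4.
  [LemarieRieusset2016]
* D. Albritton, T. Barker, J. Math. Fluid Mech. 21 (2019) = arXiv:1811.00502, Lemma 2.6, §3.
  [AlbrittonBarker2019]
* S. Gustafson, K. Kang, T.-P. Tsai, Comm. Math. Phys. 273 (2007), Thm 1.1. [GustafsonKangTsai2007]
* G. Koch, N. Nadirashvili, G. Seregin, V. Šverák, Acta Math. 203 (2009), §1 (L).
  [KochNadirashviliSereginSverak2009]
-/

noncomputable section

set_option linter.dupNamespace false -- nested layout Summit.<S>.<Sub>, Sub = S (D-0017)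

open Set MeasureTheory Filter Topology Metric Function
open scoped ENNReal NNReal
open Literature.Analysis Literature.Analysis.FluidPDE

namespace Summit.NavierStokesRegularity.NavierStokesRegularity.Theorems.BoundedEnvelope

/-! ### Two elementary facts -/

/-- A vector with `c ‖a‖ ≤ K` for every `c ≥ c₀` is zero. [folklore] -/
theorem eq_zero_of_forall_mul_norm_le {E : Type*} [NormedAddCommGroup E] {a : E} {K c₀ : ℝ}
    (h : ∀ c : ℝ, c₀ ≤ c → c * ‖a‖ ≤ K) : a = 0 := by
  by_contra ha
  have hpos : 0 < ‖a‖ := norm_pos_iff.2 ha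
  -- take `c = max c₀ ((K + 1) / ‖a‖)`
  have h1 := h (max c₀ ((K + 1) / ‖a‖)) (le_max_left _ _)
  have h2 : (K + 1) / ‖a‖ * ‖a‖ ≤ max c₀ ((K + 1) / ‖a‖) * ‖a‖ :=
    mul_le_mul_of_nonneg_right (le_max_right _ _) hpos.le
  rw [div_mul_cancel₀ _ hpos.ne'] at h2
  linarith

/-- **An a.e. bound for a continuous function on an open set holds everywhere on it** (the
exceptional set is open and null, hence empty: Lebesgue measure charges open sets). [folklore] -/
theorem forall_norm_le_of_ae_restrict_of_continuousOn
    {w : ℝ × EuclideanSpace ℝ (Fin 3) → EuclideanSpace ℝ (Fin 3)} {U : Set (ℝ × EuclideanSpace ℝ (Fin 3))}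
    (hU : IsOpen U) (hw : ContinuousOn w U) {K : ℝ}
    (hae : ∀ᵐ z ∂(volume.restrict U), ‖w z‖ ≤ K) : ∀ z ∈ U, ‖w z‖ ≤ K := by
  set O : Set (ℝ × EuclideanSpace ℝ (Fin 3)) := U ∩ w ⁻¹' {a | K < ‖a‖} with hO
  have hOopen : IsOpen O :=
    hw.isOpen_inter_preimage hU (isOpen_lt continuous_const continuous_norm)
  have hOnull : volume O = 0 := by
    have h := ae_iff.1 hae
    rw [Measure.restrict_apply' hU.measurableSet] at h
    have e : {z : ℝ × EuclideanSpace ℝ (Fin 3) | ¬‖w z‖ ≤ K} ∩ U = O := by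
      ext z
      simp only [hO, mem_inter_iff, mem_setOf_eq, mem_preimage, not_le]
      tauto
    rwa [e] at h
  have hOempty : O = ∅ := (hOopen.measure_eq_zero_iff volume).1 hOnull
  intro z hz
  by_contra hlt
  push Not at hlt
  have : z ∈ O := ⟨hz, hlt⟩
  rw [hOempty] at this
  exact this

/-! ### The Liouville theorem in the small-Morrey regime -/

/-- **(L_M) for a small Morrey constant** (statement and proof in the module docstring): there
is a universal `M₀ > 0` such that every bounded ancient mild solution (`ν = 1`), jointly smooth
and Oseen-mild on `(-∞,0) × ℝ³`, with `∫_{B_r(y)} ‖v t‖² ≤ M₀ r` for all `t < 0`, `y`, `r > 0`,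
vanishes identically.
[cite: CaffarelliKohnNirenberg1982, Prop. 1; LemarieRieusset2016, Thm 14.4; AlbrittonBarker2019, Lemma 2.6] -/
theorem liouvilleMorrey_small : ∃ M₀ : ℝ, 0 < M₀ ∧ ∀ v : ℝ → EuclideanSpace ℝ (Fin 3) →
    EuclideanSpace ℝ (Fin 3), IsBoundedAncientMildSolution 1 v → ContDiffOn ℝ (⊤ : ℕ∞) (uncurry v)
    (Set.Iio 0 ×ˢ Set.univ) → (∀ s t : ℝ, s < t → t < 0 → ∀ x, v t x =
    UnboundedOperators.heatExtension (v s) (t - s) x - oseenDuhamel 1 s v v t x) → (∀ t < 0, ∀ (y :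
    EuclideanSpace ℝ (Fin 3)) (r : ℝ), 0 < r → ∫ x in Metric.ball y r, ‖v t x‖ ^ 2 ≤ M₀ * r) →
    ∀ t < 0, ∀ x, v t x = 0 := by
  -- ### the ε-regularity constants and the threshold of part 1
  obtain ⟨ε₀, C₀, hε₀, hC₀, HREG⟩ :=
    lemarieRieusset_epsilon_regularity_nu_one_holds 3 (by norm_num)
  set l : ℝ := ε₀ with hl
  set η : ℝ≥0∞ := ENNReal.ofReal (l ^ 3) / 5 with hη
  have hl3 : 0 < l ^ 3 := by positivity
  have hη0 : 0 < η := ENNReal.div_pos (ENNReal.ofReal_pos.2 hl3).ne' ENNReal.ofNat_ne_top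
  have hηt : η ≠ ⊤ := ENNReal.div_ne_top ENNReal.ofReal_ne_top (by norm_num)
  have h5η : 5 * η = ENNReal.ofReal (l ^ 3) := by
    rw [hη, ENNReal.mul_div_cancel (by norm_num) ENNReal.ofNat_ne_top]
  obtain ⟨M₀, hM₀, HSMALL⟩ := cknC_cknDOsc_small_of_morrey η hη0
  refine ⟨M₀, hM₀, ?_⟩
  -- ### a solution in the small-Morrey regime
  intro v hmild hsm hoseen hMor t ht x
  obtain ⟨V', hV'⟩ := hmild.2
  set V : ℝ := max V' 0 with hVdef
  have hV0 : 0 ≤ V := le_max_right _ _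
  have hbd : ∀ t < 0, ∀ x, ‖v t x‖ ≤ V := fun t ht x => (hV' t ht x).trans (le_max_left _ _)
  have hcont : ContinuousOn (uncurry v) (Iio (0 : ℝ) ×ˢ univ) := hsm.continuousOn
  -- the classical pressure
  obtain ⟨P, hcl⟩ :=
    HardyAncientLimit.exists_isClassicalNSSolutionOn_Iio_of_oseen hcont hV0 hbd hmild.1 hoseen
  -- ### `c ‖v t x‖ ≤ C₀ l` for every large zoom factor `c`
  set c₀ : ℝ := 2 * Real.sqrt (-t) + 1 with hc₀
  have hc₀pos : 0 < c₀ := by rw [hc₀]; positivity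
  suffices key : ∀ c : ℝ, c₀ ≤ c → c * ‖v t x‖ ≤ C₀ * l from
    eq_zero_of_forall_mul_norm_le key
  intro c hc
  have hcpos : 0 < c := hc₀pos.trans_le hc
  -- `s = t / c² ∈ (-1/4, 0)`
  have hct : -t * 4 < c ^ 2 := by
    have hs : Real.sqrt (-t) ^ 2 = -t := Real.sq_sqrt (by linarith)
    nlinarith [Real.sqrt_nonneg (-t)]
  set s : ℝ := t / c ^ 2 with hs
  have hc2 : 0 < c ^ 2 := by positivity
  have hs0 : s < 0 := div_neg_of_neg_of_pos ht hc2
  have hs4 : -(1 / 4 : ℝ) < s := by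
    rw [hs, lt_div_iff₀ hc2]; linarith
  -- ### the zoom about `(0, x)` with factor `c`
  set w : ℝ → EuclideanSpace ℝ (Fin 3) → EuclideanSpace ℝ (Fin 3) := c • stPull (c ^ 2) c 0 x v with hw
  set Pw : ℝ → EuclideanSpace ℝ (Fin 3) → ℝ := c ^ 2 • stPull (c ^ 2) c 0 x P with hPw
  obtain ⟨hclw, hMorw, hbdw⟩ := zoom_setting hcl hMor hbd hcpos (le_refl (0 : ℝ)) x
  have hwval : w s 0 = c • v t x := by
    rw [hw, smul_stPull_apply]
    congr 2
    · rw [hs, zero_add, mul_div_cancel₀ _ hc2.ne']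
    · rw [smul_zero, add_zero]
  -- smallness of `C` and `D` on the unit ball about the origin (part 1)
  obtain ⟨hCw, hDw⟩ := HSMALL w Pw M₀ (c * V) hM₀.le le_rfl (mul_nonneg hcpos.le hV0) hclw hMorw hbdw
    1 one_pos 0 (le_refl (0 : ℝ))
  -- ### the suitable weak solution on the slab with normalised pressure
  have hQ : (((Literature.Analysis.FluidPDE.slab (EuclideanSpace ℝ (Fin 3)) (Set.Iio (0 : ℝ))
      isOpen_Iio) : TopologicalSpace.Opens (ℝ × EuclideanSpace ℝ (Fin 3))) :
      Set (ℝ × EuclideanSpace ℝ (Fin 3))) ⊆ Iio (0 : ℝ) ×ˢ univ := by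
    rw [coe_slab]
  have hsw : IsSuitableWeakSolutionOn (Literature.Analysis.FluidPDE.slab (EuclideanSpace ℝ (Fin 3))
      (Set.Iio (0 : ℝ)) isOpen_Iio) 1 0 w Pw := by
    refine isSuitableWeakSolutionOn_of_contDiffOn isOpen_Iio hQ
      (hclw.smooth_velocity.of_le (by norm_cast)) (hclw.smooth_pressure.of_le (by norm_cast))
      continuousOn_const (fun t ht x => ?_) hclw.divFree
    have hmom := hclw.momentum t ht x
    rwa [timeDerivWithin_apply, derivWithin_of_isOpen isOpen_Iio ht, ← timeDeriv_apply] at hmom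
  set Pn : ℝ → EuclideanSpace ℝ (Fin 3) → ℝ :=
    fun t y => Pw t y - ⨍ y' in ball (0 : EuclideanSpace ℝ (Fin 3)) 1, Pw t y' with hPn
  have hswn : IsSuitableWeakSolutionOn (Literature.Analysis.FluidPDE.slab (EuclideanSpace ℝ (Fin 3))
      (Set.Iio (0 : ℝ)) isOpen_Iio) 1 0 w Pn := hsw.sub_unitBallMean_slab
  set G : ℝ → EuclideanSpace ℝ (Fin 3) → EuclideanSpace ℝ (Fin 3) →L[ℝ] EuclideanSpace ℝ (Fin 3) :=
    fun t y => fderiv ℝ (w t) y with hG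
  have hwg : HasWeakSpatialGradientOn (Literature.Analysis.FluidPDE.slab (EuclideanSpace ℝ (Fin 3))
      (Set.Iio (0 : ℝ)) isOpen_Iio) w G :=
    hasWeakSpatialGradientOn_of_contDiffOn isOpen_Iio hQ (hclw.smooth_velocity.of_le (by norm_cast))
  -- the unit ball about the origin lies in the slab
  have h10 : parabolicCylinder 1 (0 : ℝ × EuclideanSpace ℝ (Fin 3)) ⊆
      (((Literature.Analysis.FluidPDE.slab (EuclideanSpace ℝ (Fin 3)) (Set.Iio (0 : ℝ)) isOpen_Iio) :
        TopologicalSpace.Opens (ℝ × EuclideanSpace ℝ (Fin 3))) : Set (ℝ × EuclideanSpace ℝ (Fin 3))) := by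
    rw [coe_slab]
    exact parabolicCylinder_subset_past (le_refl (0 : ℝ))
  -- ### finiteness of `A`, `E` and of the plain `D` of the normalised pressure at `Q(0,1)`
  have hcontw : ∀ t < 0, Continuous (w t) := fun t ht => (hclw.contDiff_velocity ht).continuous
  have hA : cknAEss 1 (0 : ℝ × EuclideanSpace ℝ (Fin 3)) w ≠ ∞ :=
    ne_top_of_le_ne_top ENNReal.ofReal_ne_top (cknAEss_le_of_morrey hcontw hMorw one_pos (le_refl _))
  obtain ⟨K, hKt, hKb⟩ := exists_abScaledSum_le_of_morrey hM₀.le (mul_nonneg hcpos.le hV0) hclw hMorw hbdw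
  have hE : cknE 1 (0 : ℝ × EuclideanSpace ℝ (Fin 3)) G ≠ ∞ :=
    ne_top_of_le_ne_top hKt (cknE_le_abScaledSum.trans (hKb 1 one_pos 0 (le_refl _)))
  -- the plain `L^{3/2}` integral of the normalised pressure: `≤ 4 D(Q(0,1); Pw) ≤ 4 η`
  have hli : LocallyIntegrableOn (uncurry Pn) (Iio (0 : ℝ) ×ˢ (univ : Set (EuclideanSpace ℝ (Fin 3))))
      volume := by
    have h := hswn.distributional.2.2.1
    rwa [coe_slab] at h
  have hliw : LocallyIntegrableOn (uncurry Pw) (((Literature.Analysis.FluidPDE.slab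
      (EuclideanSpace ℝ (Fin 3)) (Set.Iio (0 : ℝ)) isOpen_Iio) :
        TopologicalSpace.Opens (ℝ × EuclideanSpace ℝ (Fin 3))) : Set (ℝ × EuclideanSpace ℝ (Fin 3)))
      volume := hsw.distributional.2.2.1
  have hDn : cknDOsc 1 (0 : ℝ × EuclideanSpace ℝ (Fin 3)) Pn = cknDOsc 1 0 Pw :=
    cknDOsc_sub_fun_time one_pos _ (ae_integrableOn_slice_of_locallyIntegrableOn_slab hliw (le_refl _))
  have hmean0 : ∀ t, ⨍ y in ball (0 : EuclideanSpace ℝ (Fin 3)) 1, Pn t y = 0 := fun t =>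
    unitBallMean_sub_unitBallMean Pw t
  have hB1 : volume (ball (0 : EuclideanSpace ℝ (Fin 3)) 1) *
      (volume (ball (0 : EuclideanSpace ℝ (Fin 3)) 1))⁻¹ = 1 :=
    ENNReal.mul_inv_cancel (measure_ball_pos volume _ one_pos).ne' measure_ball_lt_top.ne
  have hP32 : ∫⁻ z in parabolicCylinder 1 (0 : ℝ × EuclideanSpace ℝ (Fin 3)), ‖Pn z.1 z.2‖ₑ ^ (3 / 2 : ℝ) ≤
      4 * η := by
    have h := lintegral_pressure_le_of_unitBallMean_eq_zero hli hmean0 (le_refl (1 : ℝ))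
    rw [hB1, ENNReal.ofReal_one, one_pow, one_mul, hDn] at h
    calc ∫⁻ z in parabolicCylinder 1 (0 : ℝ × EuclideanSpace ℝ (Fin 3)), ‖Pn z.1 z.2‖ₑ ^ (3 / 2 : ℝ)
        ≤ 2 * (1 + 1) * cknDOsc 1 0 Pw := h
      _ ≤ 2 * (1 + 1) * η := by gcongr
      _ = 4 * η := by norm_num
  have hD : cknD 1 (0 : ℝ × EuclideanSpace ℝ (Fin 3)) Pn ≠ ∞ := by
    unfold cknD
    rw [ENNReal.ofReal_one, one_pow, inv_one, one_mul]
    exact ne_top_of_le_ne_top (ENNReal.mul_ne_top ENNReal.ofNat_ne_top hηt) hP32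
  -- ### Lemarié-Rieusset's §14.3 class on the top-touching cylinder `Q(0,1)`
  obtain ⟨G', hLR⟩ := Seregin2020.exists_isLRSuitableWeakSolutionOn_of_finite hswn hwg one_pos h10
    hA hE hD 3
  -- ### the smallness hypothesis of the ε-regularity criterion
  have hCint : ∫⁻ z in parabolicCylinder 1 (0 : ℝ × EuclideanSpace ℝ (Fin 3)), ‖w z.1 z.2‖ₑ ^ (3 : ℕ) ≤ η := by
    have e : cknC 1 (0 : ℝ × EuclideanSpace ℝ (Fin 3)) w =
        ∫⁻ z in parabolicCylinder 1 (0 : ℝ × EuclideanSpace ℝ (Fin 3)), ‖w z.1 z.2‖ₑ ^ (3 : ℕ) := by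
      unfold cknC
      rw [ENNReal.ofReal_one, one_pow, inv_one, one_mul]
    rw [← e]
    exact hCw
  have hmeasw : AEMeasurable (fun z : ℝ × EuclideanSpace ℝ (Fin 3) => ‖w z.1 z.2‖ₑ ^ (3 : ℕ))
      (volume.restrict (parabolicCylinder 1 (0 : ℝ × EuclideanSpace ℝ (Fin 3)))) := by
    have hc : ContinuousOn (uncurry w) (parabolicCylinder 1 (0 : ℝ × EuclideanSpace ℝ (Fin 3))) :=
      hclw.smooth_velocity.continuousOn.mono (parabolicCylinder_subset_past (le_refl (0 : ℝ)))
    exact ((hc.aestronglyMeasurable (isOpen_parabolicCylinder _ _).measurableSet).aemeasurable.enorm.pow_const _)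
  have hsmall : ∫⁻ z in parabolicCylinder 1 (0 : ℝ × EuclideanSpace ℝ (Fin 3)),
      (‖w z.1 z.2‖ₑ ^ (3 : ℕ) + ‖Pn z.1 z.2‖ₑ ^ (3 / 2 : ℝ)) ≤ ENNReal.ofReal (l ^ 3) := by
    rw [lintegral_add_left' hmeasw, ← h5η]
    calc (∫⁻ z in parabolicCylinder 1 (0 : ℝ × EuclideanSpace ℝ (Fin 3)), ‖w z.1 z.2‖ₑ ^ (3 : ℕ)) +
          ∫⁻ z in parabolicCylinder 1 (0 : ℝ × EuclideanSpace ℝ (Fin 3)), ‖Pn z.1 z.2‖ₑ ^ (3 / 2 : ℝ)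
        ≤ η + 4 * η := add_le_add hCint hP32
      _ = 5 * η := by ring
  have hforce : ∫⁻ z in parabolicCylinder 1 (0 : ℝ × EuclideanSpace ℝ (Fin 3)),
      ‖(0 : ℝ → EuclideanSpace ℝ (Fin 3) → EuclideanSpace ℝ (Fin 3)) z.1 z.2‖ₑ ^ (3 : ℝ) ≤
        ENNReal.ofReal (l ^ (2 * (3 : ℝ))) := by
    simp [ENNReal.zero_rpow_of_pos (by norm_num : (0 : ℝ) < 3)]
  -- ### ε-regularity: `‖w‖ ≤ C₀ l` a.e. on `Q(0,½)`, hence everywhere there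
  have hae := HREG _ 0 w Pn G' hLR 0 l le_rfl hε₀.le (le_refl l) hsmall hforce
  have hopen : IsOpen (parabolicCylinder (1 / 2) (0 : ℝ × EuclideanSpace ℝ (Fin 3))) :=
    isOpen_parabolicCylinder _ _
  have hsub : parabolicCylinder (1 / 2) (0 : ℝ × EuclideanSpace ℝ (Fin 3)) ⊆ Iio (0 : ℝ) ×ˢ univ :=
    parabolicCylinder_subset_past (le_refl (0 : ℝ))
  have hcw : ContinuousOn (uncurry w) (parabolicCylinder (1 / 2) (0 : ℝ × EuclideanSpace ℝ (Fin 3))) :=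
    hclw.smooth_velocity.continuousOn.mono hsub
  have hall := forall_norm_le_of_ae_restrict_of_continuousOn hopen hcw hae
  -- ### evaluation at `(s, 0)`
  have hmem : ((s, (0 : EuclideanSpace ℝ (Fin 3))) : ℝ × EuclideanSpace ℝ (Fin 3)) ∈
      parabolicCylinder (1 / 2) (0 : ℝ × EuclideanSpace ℝ (Fin 3)) := by
    rw [mem_parabolicCylinder]
    refine ⟨⟨?_, ?_⟩, ?_⟩
    · show (0 : ℝ × EuclideanSpace ℝ (Fin 3)).1 - (1 / 2) ^ 2 < s
      simp only [Prod.fst_zero]; linarith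
    · show s < (0 : ℝ × EuclideanSpace ℝ (Fin 3)).1
      simpa using hs0
    · simp
  have h := hall _ hmem
  change ‖w s 0‖ ≤ C₀ * l at h
  rw [hwval, norm_smul, Real.norm_of_nonneg hcpos.le] at h
  exact h

end Summit.NavierStokesRegularity.NavierStokesRegularity.Theorems.BoundedEnvelope

end
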